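import Literature.Geometry.Kaehler.NearlyHolomorphicCycleSupportLine
import Literature.AlgebraicGeometry.HodgeTheory.HodgeFiltrationModels
import Literature.AlgebraicGeometry.HodgeTheory.AlgebraicClasses

/-!
# Route HolomorphicityRate — `ThresholdForcesHodgeType` (stmt-HodgeConjecture-10764): the classes
# supported on a nearly holomorphic cycle support form a line (T1 of the tilt inequality)

The first sentence of the printed proof of the item ("`S ∖ Sg` connected and nearly complex ⟹
`H²ᵖ_S(X^an) = ℂ · [S]` (Thom isomorphism off an analytic set of codim `≥ p + 1`), so
`γ_k = λ [S]`"), in the item's own vocabulary: for a Hodge model `A` of `X`, a smooth metric `g`, a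
nearly holomorphic cycle support `(S, Sg)` of codimension `p ≥ 1` and any defect in `X^an`, the
classes `γ ∈ H²ᵖ(X(ℂ); ℂ)` whose pull-back `A^* γ` restricts to `0` on `X^an ∖ S` are the multiples
of one class (`holomorphicityRate_supportedClasses_le_span`). It is the Literature theorem
`Literature.Geometry.Kaehler.IsNearlyHolomorphicCycleSupport.exists_ker_map_compl_le_span`
(`Geometry/Kaehler/NearlyHolomorphicCycleSupportLine`: analytic semipurity for the bad set, the
tubular-neighbourhood-free critical local homology for the good part, Kronecker duality) pulled back
along the bijective comparison `A.pullback`. Helper for the item (`--supports`); what remains of the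
tilt inequality `HolomorphicityRate.TiltInequality` after this is the identification of the generator
with the current of integration and the mass / tilt estimates (T2–T4).
-/

-- `Summit.HodgeConjecture.HodgeConjecture.Theorems` is the mandated namespace (single-problem summit:
-- Problem = Summit), which `linter.dupNamespace` flags on every declaration; the lakefile turns the
-- linter off tree-wide (weak option), restated here so stand-alone elaboration is warning-free too.
set_option linter.dupNamespace false

noncomputable section

namespace Summit.HodgeConjecture.HodgeConjecture.Theorems

open scoped Manifold ContDiff Topology
open Set Function
open Literature.AlgebraicGeometry.HodgeTheory Literature.AlgebraicGeometry.Motives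
  Literature.AlgebraicTopology.SingularHomology Literature.Geometry.Kaehler

/-- **T1 of the tilt inequality, in the item's vocabulary: the classes of `H²ᵖ(X(ℂ); ℂ)` whose
pull-back to a Hodge model dies off a nearly holomorphic cycle support form a line.** For `X` with a
Hodge model `A`, a smooth metric `g` on `X^an`, `p ≥ 1` and a nearly holomorphic cycle support
`(S, Sg)` of codimension `p` and any defect `t` in `X^an = A.carrier`, there is `τ ∈ H²ᵖ(X(ℂ); ℂ)`
such that every `γ` with `(A^* γ)|_{X^an ∖ S} = 0` is a multiple of `τ`
(`IsNearlyHolomorphicCycleSupport.exists_ker_map_compl_le_span` on the second countable complex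
manifold `A.carrier`, pulled back along the bijective comparison `A.pullback`). This is the sentence
"`H²ᵖ_S(X^an) = ℂ · [S]` (Thom isomorphism off an analytic set of codim `≥ p + 1`)" of the item
`ThresholdForcesHodgeType` (stmt-HodgeConjecture-10764). [cite: VoisinHodgeI2002, §11.1.2 Lemma 11.13]
[cite: King1971] -/
theorem holomorphicityRate_supportedClasses_le_span {n : ℕ} {X : SchemeOver ℂ} (A : HodgeModel n X)
    (g : Bundle.ContMDiffRiemannianMetric 𝓘(ℝ, A.model) ((⊤ : ℕ∞) : WithTop ℕ∞) A.model
      (fun x : A.carrier => TangentSpace 𝓘(ℝ, A.model) x))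
    {p : ℕ} (hp : 1 ≤ p) {t : ℝ} {S Sg : Set A.carrier}
    (hS : IsNearlyHolomorphicCycleSupport g.toRiemannianMetric p t S Sg) :
    ∃ τ : complexBetti X (2 * p), ∀ γ : complexBetti X (2 * p),
      singularCohomology.map ℂ ℂ
        (⟨Subtype.val, continuous_subtype_val⟩ : C({x : A.carrier // x ∉ S}, A.carrier))
        (2 * p) (A.pullback (2 * p) γ) = 0 →
      γ ∈ Submodule.span ℂ ({τ} : Set (complexBetti X (2 * p))) := by
  haveI : SecondCountableTopology A.carrier := ChartedSpace.secondCountable_of_sigmaCompact A.model A.carrier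
  obtain ⟨τM, hτM⟩ := hS.exists_ker_map_compl_le_span hp
  -- the subspace of such classes, and its image under the one-to-one pull-back
  let K : Submodule ℂ (complexBetti X (2 * p)) :=
    LinearMap.ker ((singularCohomology.map ℂ ℂ (subsetIncl (Sᶜ : Set A.carrier)) (2 * p)).hom ∘ₗ
      (A.pullback (2 * p)).hom)
  obtain ⟨v, hv⟩ := exists_le_span_singleton_of_injective' (A.pullback (2 * p)).hom
    (A.pullback_injective (2 * p)) K τM fun x hx ↦ hτM (LinearMap.mem_ker.2 (LinearMap.mem_ker.1 hx))
  refine ⟨v, fun γ hγ ↦ hv ?_⟩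
  exact LinearMap.mem_ker.2 hγ

end Summit.HodgeConjecture.HodgeConjecture.Theorems

end
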